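import Mathlib
import HarnessLib

/-!
# One-dimensional sieve sums: `Σ_{n ≤ x, (n,W)=1} μ²(n) ∏_{p ∣ n}(1 + c_p) / n`

Topic `Literature/NumberTheory/Sieve`. The elementary two-sided asymptotics for the one-variable
sums that appear when the Maynard–Tao sieve (J. Maynard, *Small gaps between primes*, Ann. of Math.
181 (2015), Lemmas 5.1–6.3) is run with the `W`-trick: for a fixed modulus `W` (in the application
`W = ∏_{p ≤ D₀} p`) and a "prime weight" `c_p = O(1/p)`,

  `Σ_{n ≤ x, (n,W)=1} μ²(n) ∏_{p∣n}(1 + c_p) / n = (φ(W)/W) · β · log x + O_W(1)`,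
  `β = 1 + O(D₀^{-1/4})` (every prime `≤ D₀` dividing `W`),

covering `Σ_{(n,W)=1} μ²(n)/φ(n)` (`c_p = 1/(p−1)`, the sum `Σ_{u<R,(u,W)=1} μ(u)²/φ(u)` of Maynard's
(5.13), (6.5), (6.10)), `Σ_{(n,W)=1} μ²(n)/n` (`c = 0`) and `Σ_{(n,W)=1} μ²(n)/g(n)` with
`g(p) = p − 2` (`c_p = 2/(p−2)`, Maynard (5.20)). The classical statements are Halberstam–Richert,
*Sieve Methods* (1974), Ch. 3, (3.1.11) and Lemma 3.1 / Ch. 5 Lemma 5.3 (sums of `μ²(d) g(d)` for a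
multiplicative `g` of dimension `1`), and Goldston–Graham–Pintz–Yıldırım, *Small gaps between products
of two primes*, Proc. LMS 98 (2009), Lemma 4 (the form cited by Maynard as Lemma 6.1); here we
prove an explicit, crude-constant version sufficient for the sieve, by an elementary route:

* `abs_sum_mul_div_sub_le` — the convolution lemma: if `Σ_{n≤y} a(n)/n = α log y + O(K)` and
  `Σ_d |b(d)| d^{-3/4} ≤ B` then `Σ_{n≤x} (b*a)(n)/n = α (Σ_{d≤x} b(d)/d) log x + O((K + 4|α|)B)`
  (Dirichlet's hyperbola rearrangement `sum_Icc_sum_divisorsAntidiagonal`, `log d/d ≤ 4 d^{-3/4}`);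
  tails `abs_sum_Ioc_div_le`;
* `abs_sum_inv_sub_log_le` — `Σ_{n≤y} 1/n = log y + O(1)` (Mathlib's harmonic bounds);
* `copInd W = 𝟙_{(·,W)=1}`, `moebiusDvd W = μ·[· ∣ W]`, both multiplicative, with
  `moebiusDvd W * ζ = copInd W`; `sum_divisors_moebius_div`: `Σ_{d∣W} μ(d)/d = φ(W)/W`;
  `abs_coprimeHarmonic_sub_le`: `Σ_{n≤y,(n,W)=1} 1/n = (φ(W)/W) log y + O(harmErr W)`,
  `harmErr W = 5τ(W) + (τ(W)+1) log W`;
* `wfun W c = μ² 𝟙_W ∏(1 + c_p)` and `bfun W c` (multiplicative, `b(p) = c_p`, `b(p²) = −(1+c_p)`,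
  `b(p^j) = 0` for `j ≥ 3`, supported on `(d,W)=1`), `bfun_mul_copInd : bfun * copInd = wfun`
  (comparison of multiplicative functions on prime powers);
* `sum_le_prod_sum_prime_pow` — `Σ_{d≤N} f(d) ≤ ∏_{p≤N} Σ_j f(p^j)` for nonnegative multiplicative `f`;
  `sum_babs_le`: `Σ_d |b_c(d)| d^{-3/4} ≤ bConst C₀ = exp(2(1+2C₀))` when `|c_p| ≤ C₀/p`
  (`Σ_p p^{-3/2} ≤ 2`);
* `abs_sum_wfun_div_sub_le` — THE ESTIMATE: for `W ≥ 1`, `|c_p| ≤ C₀/p`, `x ≥ 1`,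
  `|Σ_{n≤x} w_c(n)/n − (φ(W)/W) β_c(x) log x| ≤ (harmErr W + 4) bConst C₀`, with
  `β_c(x) = Σ_{d≤x} b_c(d)/d` and `abs_bsum_sub_one_le`: `|β_c(x) − 1| ≤ bConst C₀ · D₀^{-1/4}` if every
  prime `≤ D₀` divides `W`.

All constants are explicit and crude; only their independence of `x` matters downstream.

## References

* H. Halberstam, H.-E. Richert, *Sieve Methods*, Academic Press 1974, Ch. 3 (3.1.11), Lemma 3.1;
  Ch. 5, Lemma 5.3. [folklore]
* D. A. Goldston, S. W. Graham, J. Pintz, C. Y. Yıldırım, *Small gaps between products of two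
  primes*, Proc. London Math. Soc. (3) 98 (2009), 741–774, Lemma 4. [folklore]
* J. Maynard, *Small gaps between primes*, Ann. of Math. (2) 181 (2015), 383–413, Lemma 6.1 and
  displays (5.13), (5.20), (6.5), (6.10). [cite: MaynardAnnals2015]
-/

open Finset Real ArithmeticFunction

open scoped ArithmeticFunction.Moebius ArithmeticFunction.zeta ArithmeticFunction.Omega

namespace Literature.NumberTheory.Sieve

namespace SquarefreeSums

/-! ### The hyperbola rearrangement and the basic convolution lemma -/

/-- `Σ_{n ≤ X} Σ_{de = n} F(d, e) = Σ_{d ≤ X} Σ_{e ≤ X/d} F(d, e)`. [folklore] -/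
theorem sum_Icc_sum_divisorsAntidiagonal {M : Type*} [AddCommMonoid M] (F : ℕ → ℕ → M)
    (X : ℕ) :
    ∑ n ∈ Icc 1 X, ∑ q ∈ n.divisorsAntidiagonal, F q.1 q.2 =
      ∑ d ∈ Icc 1 X, ∑ e ∈ Icc 1 (X / d), F d e := by
  rw [← Finset.sum_biUnion (s := Icc 1 X) (t := Nat.divisorsAntidiagonal)]
  · apply Finset.sum_finset_product
    intro q
    simp only [Finset.mem_biUnion, Finset.mem_Icc, Nat.mem_divisorsAntidiagonal]
    constructor
    · rintro ⟨n, ⟨-, hnX⟩, hq, hn0⟩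
      subst hq
      have hd : 0 < q.1 := Nat.pos_of_ne_zero fun h => hn0 (by simp [h])
      have he : 0 < q.2 := Nat.pos_of_ne_zero fun h => hn0 (by simp [h])
      refine ⟨⟨hd, le_trans (Nat.le_mul_of_pos_right _ he) hnX⟩, he, ?_⟩
      exact (Nat.le_div_iff_mul_le hd).2 (by rw [mul_comm]; exact hnX)
    · rintro ⟨⟨hd1, -⟩, he1, heX⟩
      have h := (Nat.le_div_iff_mul_le (by omega)).1 heX
      refine ⟨q.1 * q.2, ⟨Nat.one_le_iff_ne_zero.2 (Nat.mul_ne_zero (by omega) (by omega)),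
        by rw [mul_comm]; exact h⟩, rfl, Nat.mul_ne_zero (by omega) (by omega)⟩
  · intro n _ n' _ hne
    simp only [Function.onFun]
    rw [Finset.disjoint_left]
    intro q hq hq'
    rw [Nat.mem_divisorsAntidiagonal] at hq hq'
    exact hne (hq.1.symm.trans hq'.1)

/-- For `d ≥ 1`: `1/d ≤ d^{-3/4}`. [folklore] -/
theorem inv_le_rpow_neg {d : ℕ} (hd : 1 ≤ d) : (1 : ℝ) / d ≤ (d : ℝ) ^ (-(3 : ℝ) / 4) := by
  have hd' : (1 : ℝ) ≤ d := by exact_mod_cast hd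
  rw [one_div, ← Real.rpow_neg_one]
  exact Real.rpow_le_rpow_of_exponent_le hd' (by norm_num)

/-- For `d ≥ 1`: `log d / d ≤ 4 d^{-3/4}` (from `log y ≤ y` at `y = d^{1/4}`). [folklore] -/
theorem log_div_le_rpow_neg {d : ℕ} (hd : 1 ≤ d) :
    Real.log d / d ≤ 4 * (d : ℝ) ^ (-(3 : ℝ) / 4) := by
  have hd' : (0 : ℝ) < d := by exact_mod_cast hd
  have h1 : Real.log d = 4 * Real.log ((d : ℝ) ^ ((1 : ℝ) / 4)) := by
    rw [Real.log_rpow hd']; ring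
  have h2 : Real.log ((d : ℝ) ^ ((1 : ℝ) / 4)) ≤ (d : ℝ) ^ ((1 : ℝ) / 4) :=
    (Real.log_le_sub_one_of_pos (Real.rpow_pos_of_pos hd' _)).trans (by linarith)
  have h3 : (d : ℝ) ^ ((1 : ℝ) / 4) / d = (d : ℝ) ^ (-(3 : ℝ) / 4) := by
    rw [div_eq_mul_inv, ← Real.rpow_neg_one, ← Real.rpow_add hd']; norm_num
  calc Real.log d / d = 4 * (Real.log ((d : ℝ) ^ ((1 : ℝ) / 4)) / d) := by rw [h1]; ring
    _ ≤ 4 * ((d : ℝ) ^ ((1 : ℝ) / 4) / d) := by gcongr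
    _ = 4 * (d : ℝ) ^ (-(3 : ℝ) / 4) := by rw [h3]

/-- **The convolution lemma.** If `Σ_{n ≤ y} a(n)/n = α log y + O(K)` for all `y ≥ 1` and
`Σ_d |b(d)| d^{-3/4} ≤ B`, then for `x ≥ 1`,
`|Σ_{n ≤ x} (b * a)(n)/n − α (Σ_{d ≤ x} b(d)/d) log x| ≤ (K + 4|α|) B`
(Dirichlet's hyperbola method with a logarithmic main term). [folklore] -/
theorem abs_sum_mul_div_sub_le {a b : ArithmeticFunction ℝ} {α K B : ℝ}
    (ha : ∀ y : ℝ, 1 ≤ y → |∑ n ∈ Icc 1 ⌊y⌋₊, a n / n - α * Real.log y| ≤ K)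
    (hb : ∀ N : ℕ, ∑ d ∈ Icc 1 N, |b d| * (d : ℝ) ^ (-(3 : ℝ) / 4) ≤ B) {x : ℝ} (hx : 1 ≤ x) :
    |∑ n ∈ Icc 1 ⌊x⌋₊, (b * a) n / n -
        α * (∑ d ∈ Icc 1 ⌊x⌋₊, b d / d) * Real.log x| ≤ (K + 4 * |α|) * B := by
  set X := ⌊x⌋₊ with hXdef
  have hx0 : 0 < x := by linarith
  have hK : 0 ≤ K := le_trans (abs_nonneg _) (ha 1 le_rfl)
  -- step 1: the hyperbola rearrangement
  have h1 : ∑ n ∈ Icc 1 X, (b * a) n / n =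
      ∑ d ∈ Icc 1 X, b d / d * ∑ e ∈ Icc 1 (X / d), a e / e := by
    have hc : ∀ n ∈ Icc 1 X, (b * a) n / (n : ℝ) =
        ∑ q ∈ n.divisorsAntidiagonal, b q.1 / q.1 * (a q.2 / q.2) := by
      intro n _
      rw [ArithmeticFunction.mul_apply, Finset.sum_div]
      refine Finset.sum_congr rfl fun q hq => ?_
      rw [Nat.mem_divisorsAntidiagonal] at hq
      have hq1 : (q.1 : ℝ) ≠ 0 := by
        have : q.1 ≠ 0 := fun h => hq.2 (by rw [← hq.1, h, zero_mul])
        exact_mod_cast this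
      have hq2 : (q.2 : ℝ) ≠ 0 := by
        have : q.2 ≠ 0 := fun h => hq.2 (by rw [← hq.1, h, mul_zero])
        exact_mod_cast this
      have hn : (n : ℝ) = q.1 * q.2 := by rw [← hq.1]; push_cast; ring
      rw [hn]
      field_simp
    rw [Finset.sum_congr rfl hc,
      sum_Icc_sum_divisorsAntidiagonal (fun d e => b d / d * (a e / e)) X]
    exact Finset.sum_congr rfl fun d _ => by rw [Finset.mul_sum]
  -- step 2: the inner sums
  have h2 : ∀ d ∈ Icc 1 X,
      |∑ e ∈ Icc 1 (X / d), a e / e - α * Real.log (x / d)| ≤ K := by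
    intro d hd
    obtain ⟨hd1, hdX⟩ := Finset.mem_Icc.1 hd
    have hd0 : (0 : ℝ) < d := by exact_mod_cast hd1
    have : X / d = ⌊x / d⌋₊ := by rw [Nat.floor_div_natCast]
    rw [this]
    apply ha
    rw [le_div_iff₀ hd0, one_mul]
    exact le_trans (by exact_mod_cast hdX) (Nat.floor_le hx0.le)
  -- step 3: combine
  have h3 : ∑ d ∈ Icc 1 X, b d / d * ∑ e ∈ Icc 1 (X / d), a e / e -
      α * (∑ d ∈ Icc 1 X, b d / d) * Real.log x =
      ∑ d ∈ Icc 1 X, (b d / d * (∑ e ∈ Icc 1 (X / d), a e / e - α * Real.log (x / d)) -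
        α * (b d / d * Real.log d)) := by
    rw [Finset.mul_sum, Finset.sum_mul, ← Finset.sum_sub_distrib]
    refine Finset.sum_congr rfl fun d hd => ?_
    obtain ⟨hd1, -⟩ := Finset.mem_Icc.1 hd
    have hd0 : (0 : ℝ) < d := by exact_mod_cast hd1
    rw [Real.log_div hx0.ne' hd0.ne']
    ring
  rw [h1, h3]
  refine (Finset.abs_sum_le_sum_abs _ _).trans ?_
  calc ∑ d ∈ Icc 1 X, |b d / d * (∑ e ∈ Icc 1 (X / d), a e / e - α * Real.log (x / d)) -
          α * (b d / d * Real.log d)|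
      ≤ ∑ d ∈ Icc 1 X, (K + 4 * |α|) * (|b d| * (d : ℝ) ^ (-(3 : ℝ) / 4)) := by
        refine Finset.sum_le_sum fun d hd => ?_
        obtain ⟨hd1, -⟩ := Finset.mem_Icc.1 hd
        have hd0 : (0 : ℝ) < d := by exact_mod_cast hd1
        have hlog : 0 ≤ Real.log d := Real.log_nonneg (by exact_mod_cast hd1)
        have e1 : |b d / d * (∑ e ∈ Icc 1 (X / d), a e / e - α * Real.log (x / d))| ≤
            |b d| * (d : ℝ) ^ (-(3 : ℝ) / 4) * K := by
          rw [abs_mul, abs_div, Nat.abs_cast]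
          refine mul_le_mul ?_ (h2 d hd) (abs_nonneg _) (by positivity)
          rw [div_eq_mul_one_div]
          exact mul_le_mul_of_nonneg_left (inv_le_rpow_neg hd1) (abs_nonneg _)
        have e2 : |α * (b d / d * Real.log d)| ≤ |α| * (4 * (|b d| * (d : ℝ) ^ (-(3 : ℝ) / 4))) := by
          rw [abs_mul]
          refine mul_le_mul_of_nonneg_left ?_ (abs_nonneg _)
          rw [abs_mul, abs_div, Nat.abs_cast, abs_of_nonneg hlog, div_mul_eq_mul_div,
            mul_div_assoc]
          calc |b d| * (Real.log d / d) ≤ |b d| * (4 * (d : ℝ) ^ (-(3 : ℝ) / 4)) :=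
                mul_le_mul_of_nonneg_left (log_div_le_rpow_neg hd1) (abs_nonneg _)
            _ = 4 * (|b d| * (d : ℝ) ^ (-(3 : ℝ) / 4)) := by ring
        calc _ ≤ |b d / d * (∑ e ∈ Icc 1 (X / d), a e / e - α * Real.log (x / d))| +
              |α * (b d / d * Real.log d)| := abs_sub _ _
          _ ≤ |b d| * (d : ℝ) ^ (-(3 : ℝ) / 4) * K +
              |α| * (4 * (|b d| * (d : ℝ) ^ (-(3 : ℝ) / 4))) := add_le_add e1 e2
          _ = (K + 4 * |α|) * (|b d| * (d : ℝ) ^ (-(3 : ℝ) / 4)) := by ring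
    _ = (K + 4 * |α|) * ∑ d ∈ Icc 1 X, |b d| * (d : ℝ) ^ (-(3 : ℝ) / 4) := by
        rw [Finset.mul_sum]
    _ ≤ (K + 4 * |α|) * B := by
        refine mul_le_mul_of_nonneg_left (hb X) (by positivity)

/-- Tails of `Σ b(d)/d`: `|Σ_{X < d ≤ Z} b(d)/d| ≤ B X^{-1/4}`. [folklore] -/
theorem abs_sum_Ioc_div_le {b : ArithmeticFunction ℝ} {B : ℝ}
    (hb : ∀ N : ℕ, ∑ d ∈ Icc 1 N, |b d| * (d : ℝ) ^ (-(3 : ℝ) / 4) ≤ B) {X Z : ℕ} (hX : 1 ≤ X) :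
    |∑ d ∈ Ioc X Z, b d / d| ≤ B * (X : ℝ) ^ (-(1 : ℝ) / 4) := by
  have hX0 : (0 : ℝ) < X := by exact_mod_cast hX
  have hB : 0 ≤ B := le_trans (by simp) (hb 0)
  refine (Finset.abs_sum_le_sum_abs _ _).trans ?_
  calc ∑ d ∈ Ioc X Z, |b d / d|
      ≤ ∑ d ∈ Ioc X Z, |b d| * (d : ℝ) ^ (-(3 : ℝ) / 4) * (X : ℝ) ^ (-(1 : ℝ) / 4) := by
        refine Finset.sum_le_sum fun d hd => ?_
        obtain ⟨hXd, -⟩ := Finset.mem_Ioc.1 hd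
        have hd0 : (0 : ℝ) < d := by exact_mod_cast (lt_of_le_of_lt (Nat.zero_le _) hXd)
        rw [abs_div, Nat.abs_cast, mul_assoc]
        rw [div_eq_mul_inv]
        refine mul_le_mul_of_nonneg_left ?_ (abs_nonneg _)
        have : ((d : ℝ))⁻¹ = (d : ℝ) ^ (-(3 : ℝ) / 4) * (d : ℝ) ^ (-(1 : ℝ) / 4) := by
          rw [← Real.rpow_add hd0, ← Real.rpow_neg_one]; norm_num
        rw [this]
        refine mul_le_mul_of_nonneg_left ?_ (by positivity)
        exact Real.rpow_le_rpow_of_nonpos hX0 (by exact_mod_cast hXd.le) (by norm_num)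
    _ = (∑ d ∈ Ioc X Z, |b d| * (d : ℝ) ^ (-(3 : ℝ) / 4)) * (X : ℝ) ^ (-(1 : ℝ) / 4) := by
        rw [Finset.sum_mul]
    _ ≤ (∑ d ∈ Icc 1 Z, |b d| * (d : ℝ) ^ (-(3 : ℝ) / 4)) * (X : ℝ) ^ (-(1 : ℝ) / 4) := by
        refine mul_le_mul_of_nonneg_right ?_ (by positivity)
        refine Finset.sum_le_sum_of_subset_of_nonneg ?_ fun _ _ _ => by positivity
        intro d hd
        rw [Finset.mem_Ioc] at hd
        rw [Finset.mem_Icc]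
        omega
    _ ≤ B * (X : ℝ) ^ (-(1 : ℝ) / 4) := by
        rw [mul_comm B]
        rw [mul_comm]
        exact mul_le_mul_of_nonneg_left (hb Z) (by positivity)

/-! ### The harmonic base case -/

/-- `|Σ_{n ≤ y} 1/n − log y| ≤ 1` for real `y ≥ 1` (Mathlib's `log_le_harmonic_floor`,
`harmonic_floor_le_one_add_log`). [folklore] -/
theorem abs_sum_inv_sub_log_le {y : ℝ} (hy : 1 ≤ y) :
    |∑ n ∈ Icc 1 ⌊y⌋₊, (1 : ℝ) / n - Real.log y| ≤ 1 := by
  have h : (harmonic ⌊y⌋₊ : ℝ) = ∑ n ∈ Icc 1 ⌊y⌋₊, (1 : ℝ) / n := by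
    rw [harmonic_eq_sum_Icc]; push_cast
    exact Finset.sum_congr rfl fun n _ => by rw [one_div]
  have h1 := log_le_harmonic_floor y (by linarith)
  have h2 := harmonic_floor_le_one_add_log y hy
  rw [← h, abs_le]
  constructor <;> linarith

/-- The base case for the constant function `1 = ζ`: `|Σ_{n ≤ y} ζ(n)/n − log y| ≤ 1`.
[folklore] -/
theorem abs_sum_zeta_div_sub_log_le (y : ℝ) (hy : 1 ≤ y) :
    |∑ n ∈ Icc 1 ⌊y⌋₊, ((ζ : ArithmeticFunction ℕ) : ArithmeticFunction ℝ) n / n -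
      1 * Real.log y| ≤ 1 := by
  rw [one_mul]
  convert abs_sum_inv_sub_log_le hy using 3
  refine Finset.sum_congr rfl fun n hn => ?_
  obtain ⟨hn1, -⟩ := Finset.mem_Icc.1 hn
  rw [ArithmeticFunction.natCoe_apply, ArithmeticFunction.zeta_apply_ne (by omega)]
  simp


/-! ### Multiplicative indicator functions -/

/-- `𝟙_W(n) = [n ≥ 1 ∧ (n, W) = 1]` as a real arithmetic function. [folklore] -/
noncomputable def copInd (W : ℕ) : ArithmeticFunction ℝ :=
  ⟨fun n => if n ≠ 0 ∧ n.Coprime W then 1 else 0, by simp⟩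

/-- Unfolding `𝟙_W`. [folklore] -/
theorem copInd_apply (W n : ℕ) :
    copInd W n = if n ≠ 0 ∧ n.Coprime W then 1 else 0 := rfl

/-- `𝟙_W(n) = 1` for `n ≥ 1` coprime to `W`. [folklore] -/
theorem copInd_apply_of_coprime {W n : ℕ} (hn : n ≠ 0) (h : n.Coprime W) : copInd W n = 1 := by
  rw [copInd_apply, if_pos ⟨hn, h⟩]

/-- `𝟙_W(n) = 0` for `n` not coprime to `W`. [folklore] -/
theorem copInd_apply_of_not_coprime {W n : ℕ} (h : ¬n.Coprime W) : copInd W n = 0 := by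
  rw [copInd_apply, if_neg (fun h' => h h'.2)]

/-- `𝟙_W ≥ 0`. [folklore] -/
theorem copInd_nonneg (W n : ℕ) : 0 ≤ copInd W n := by
  rw [copInd_apply]; split_ifs <;> norm_num

/-- `𝟙_W ≤ 1`. [folklore] -/
theorem copInd_le_one (W n : ℕ) : copInd W n ≤ 1 := by
  rw [copInd_apply]; split_ifs <;> norm_num

/-- `𝟙_W` is multiplicative. [folklore] -/
theorem isMultiplicative_copInd (W : ℕ) : (copInd W).IsMultiplicative := by
  refine IsMultiplicative.iff_ne_zero.2 ⟨?_, ?_⟩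
  · rw [copInd_apply, if_pos ⟨one_ne_zero, Nat.coprime_one_left W⟩]
  · intro m n hm hn _
    have hmn0 : m * n ≠ 0 := Nat.mul_ne_zero hm hn
    by_cases h : (m * n).Coprime W
    · obtain ⟨h1, h2⟩ := Nat.coprime_mul_iff_left.1 h
      rw [copInd_apply_of_coprime hmn0 h, copInd_apply_of_coprime hm h1,
        copInd_apply_of_coprime hn h2, mul_one]
    · rw [copInd_apply_of_not_coprime h]
      rw [Nat.coprime_mul_iff_left, not_and_or] at h
      rcases h with h | h
      · rw [copInd_apply_of_not_coprime h, zero_mul]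
      · rw [copInd_apply_of_not_coprime h, mul_zero]

/-- `μ(d) · [d ∣ W]` as a real arithmetic function. [folklore] -/
noncomputable def moebiusDvd (W : ℕ) : ArithmeticFunction ℝ :=
  ⟨fun d => if d ≠ 0 ∧ d ∣ W then (μ d : ℝ) else 0, by simp⟩

/-- Unfolding `μ · [· ∣ W]`. [folklore] -/
theorem moebiusDvd_apply (W d : ℕ) :
    moebiusDvd W d = if d ≠ 0 ∧ d ∣ W then (μ d : ℝ) else 0 := rfl

/-- `|μ(d) [d ∣ W]| ≤ [d ∣ W]`. [folklore] -/
theorem abs_moebiusDvd_le (W d : ℕ) : |moebiusDvd W d| ≤ if d ∣ W then 1 else 0 := by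
  rw [moebiusDvd_apply]
  split_ifs with h h'
  · have := abs_moebius_le_one (n := d)
    exact_mod_cast this
  · exact absurd h.2 h'
  · simp
  · simp

/-- `μ · [· ∣ W]` is multiplicative. [folklore] -/
theorem isMultiplicative_moebiusDvd (W : ℕ) : (moebiusDvd W).IsMultiplicative := by
  refine IsMultiplicative.iff_ne_zero.2 ⟨?_, ?_⟩
  · simp [moebiusDvd_apply]
  · intro m n hm hn hmn
    simp only [moebiusDvd_apply, ne_eq, mul_eq_zero, hm, hn, or_self, not_false_eq_true,
      true_and]
    by_cases h : m * n ∣ W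
    · rw [if_pos h, if_pos (dvd_trans (dvd_mul_right m n) h),
        if_pos (dvd_trans (dvd_mul_left n m) h),
        ArithmeticFunction.isMultiplicative_moebius.map_mul_of_coprime hmn]
      push_cast; ring
    · rw [if_neg h]
      by_cases h1 : m ∣ W
      · have h2 : ¬n ∣ W := fun h2 => h (hmn.mul_dvd_of_dvd_of_dvd h1 h2)
        rw [if_neg h2, mul_zero]
      · rw [if_neg h1, zero_mul]

/-- `Σ_{d ∣ n, d ∣ W} μ(d) = [(n, W) = 1]`, i.e. `moebiusDvd W * ζ = 𝟙_W`. [folklore] -/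
theorem moebiusDvd_mul_zeta (W : ℕ) :
    moebiusDvd W * ((ζ : ArithmeticFunction ℕ) : ArithmeticFunction ℝ) = copInd W := by
  have hζ : ((ζ : ArithmeticFunction ℕ) : ArithmeticFunction ℝ).IsMultiplicative :=
    isMultiplicative_zeta.natCast
  rw [(isMultiplicative_moebiusDvd W).mul hζ |>.eq_iff_eq_on_prime_powers _ _
    (isMultiplicative_copInd W)]
  intro p i hp
  rw [ArithmeticFunction.coe_mul_zeta_apply, Nat.sum_divisors_prime_pow hp]
  rcases Nat.eq_zero_or_pos i with rfl | hi
  · simp [moebiusDvd_apply, copInd_apply]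
  -- `Σ_{j ≤ i} μ(p^j)[p^j ∣ W] = 1 + μ(p)[p ∣ W]`
  have h0 : moebiusDvd W (p ^ 0) = 1 := by simp [moebiusDvd_apply]
  have htail : ∑ j ∈ Finset.range i, moebiusDvd W (p ^ (j + 1)) = moebiusDvd W p := by
    obtain ⟨i', rfl⟩ := Nat.exists_eq_succ_of_ne_zero hi.ne'
    rw [Finset.sum_range_succ', zero_add, pow_one, Finset.sum_eq_zero, zero_add]
    intro j _
    rw [moebiusDvd_apply]
    split_ifs with h
    · rw [ArithmeticFunction.moebius_apply_prime_pow hp (by omega : j + 1 + 1 ≠ 0)]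
      simp
    · rfl
  rw [Finset.sum_range_succ', htail, h0, copInd_apply]
  by_cases hpW : p ∣ W
  · have hnc : ¬(p ^ i).Coprime W := fun hc =>
      hp.ne_one (Nat.Coprime.eq_one_of_dvd ((Nat.coprime_pow_left_iff hi _ _).1 hc) hpW)
    rw [if_neg (fun h' => hnc h'.2), moebiusDvd_apply, if_pos ⟨hp.ne_zero, hpW⟩,
      ArithmeticFunction.moebius_apply_prime hp]
    push_cast; ring
  · have hc : (p ^ i).Coprime W :=
      (Nat.coprime_pow_left_iff hi _ _).2 ((Nat.Prime.coprime_iff_not_dvd hp).2 hpW)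
    rw [if_pos ⟨pow_ne_zero _ hp.ne_zero, hc⟩, moebiusDvd_apply, if_neg (fun h' => hpW h'.2)]
    ring


/-! ### The coprime harmonic sum `H_W(y) = Σ_{n ≤ y, (n,W)=1} 1/n` -/

/-- `Σ_{d ∣ W} μ(d)/d = φ(W)/W` (Möbius inversion of `Σ_{d ∣ n} φ(d) = n`). [folklore] -/
theorem sum_divisors_moebius_div (W : ℕ) (hW : W ≠ 0) :
    ∑ d ∈ W.divisors, (μ d : ℝ) / d = (W.totient : ℝ) / W := by
  have key : ∀ n > 0, ∑ x ∈ n.divisorsAntidiagonal, (μ x.1 : ℝ) * (x.2 : ℝ) = (n.totient : ℝ) := by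
    refine (ArithmeticFunction.sum_eq_iff_sum_mul_moebius_eq (R := ℝ)
      (f := fun n => (n.totient : ℝ)) (g := fun n => (n : ℝ))).1 (fun n _ => ?_)
    exact_mod_cast Nat.sum_totient n
  have hW0 : (W : ℝ) ≠ 0 := by exact_mod_cast hW
  rw [eq_div_iff hW0, ← key W (Nat.pos_of_ne_zero hW),
    Nat.sum_divisorsAntidiagonal (f := fun d e => (μ d : ℝ) * (e : ℝ)), Finset.sum_mul]
  refine Finset.sum_congr rfl fun d hd => ?_
  have hdW : d ∣ W := Nat.dvd_of_mem_divisors hd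
  have hd0 : (d : ℝ) ≠ 0 := by exact_mod_cast (Nat.pos_of_mem_divisors hd).ne'
  rw [Nat.cast_div hdW hd0]
  field_simp

/-- The `d^{-3/4}`-moment of `moebiusDvd W` is at most `τ(W)` (`W ≥ 1`). [folklore] -/
theorem sum_abs_moebiusDvd_le {W : ℕ} (hW : W ≠ 0) (N : ℕ) :
    ∑ d ∈ Icc 1 N, |moebiusDvd W d| * (d : ℝ) ^ (-(3 : ℝ) / 4) ≤ (W.divisors.card : ℝ) := by
  calc ∑ d ∈ Icc 1 N, |moebiusDvd W d| * (d : ℝ) ^ (-(3 : ℝ) / 4)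
      ≤ ∑ d ∈ Icc 1 N, (if d ∣ W then (1 : ℝ) else 0) := by
        refine Finset.sum_le_sum fun d hd => ?_
        obtain ⟨hd1, -⟩ := Finset.mem_Icc.1 hd
        have h1 : (d : ℝ) ^ (-(3 : ℝ) / 4) ≤ 1 :=
          Real.rpow_le_one_of_one_le_of_nonpos (by exact_mod_cast hd1) (by norm_num)
        calc |moebiusDvd W d| * (d : ℝ) ^ (-(3 : ℝ) / 4) ≤ |moebiusDvd W d| * 1 :=
              mul_le_mul_of_nonneg_left h1 (abs_nonneg _)
          _ ≤ _ := by rw [mul_one]; exact abs_moebiusDvd_le W d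
    _ = (((Icc 1 N).filter (· ∣ W)).card : ℝ) := by
        rw [Finset.sum_ite, Finset.sum_const_zero, add_zero, Finset.sum_const, nsmul_eq_mul,
          mul_one]
    _ ≤ (W.divisors.card : ℝ) := by
        gcongr
        intro d hd
        simp only [Finset.mem_filter, Finset.mem_Icc] at hd
        exact Nat.mem_divisors.2 ⟨hd.2, hW⟩

/-- For `⌊y⌋ ≥ W`: `Σ_{d ≤ y} μ(d)[d ∣ W]/d = φ(W)/W`. [folklore] -/
theorem sum_moebiusDvd_div_eq {W : ℕ} (hW : W ≠ 0) {Y : ℕ} (hY : W ≤ Y) :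
    ∑ d ∈ Icc 1 Y, moebiusDvd W d / d = (W.totient : ℝ) / W := by
  rw [← sum_divisors_moebius_div W hW]
  have hsub : W.divisors ⊆ Icc 1 Y := fun d hd =>
    Finset.mem_Icc.2 ⟨Nat.pos_of_mem_divisors hd, (Nat.divisor_le hd).trans hY⟩
  rw [← Finset.sum_subset hsub (f := fun d => moebiusDvd W d / d) fun d _ hnd => ?_]
  · refine Finset.sum_congr rfl fun d hd => ?_
    rw [moebiusDvd_apply, if_pos ⟨(Nat.pos_of_mem_divisors hd).ne', Nat.dvd_of_mem_divisors hd⟩]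
  · have : ¬d ∣ W := fun h => hnd (Nat.mem_divisors.2 ⟨h, hW⟩)
    rw [moebiusDvd_apply, if_neg (fun h' => this h'.2), zero_div]

/-- The error constant of the coprime harmonic sum: `5 τ(W) + (τ(W) + 1) log W`. [folklore] -/
noncomputable def harmErr (W : ℕ) : ℝ :=
  5 * W.divisors.card + (W.divisors.card + 1) * Real.log W

/-- The harmonic error constant is nonnegative. [folklore] -/
theorem harmErr_nonneg (W : ℕ) : 0 ≤ harmErr W := by
  unfold harmErr
  have : 0 ≤ Real.log W := Real.log_natCast_nonneg W
  positivity

/-- **The coprime harmonic sum.** For `W ≥ 1` and real `y ≥ 1`,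
`|Σ_{n ≤ y, (n,W)=1} 1/n − (φ(W)/W) log y| ≤ 5 τ(W) + (τ(W) + 1) log W`. [folklore] -/
theorem abs_coprimeHarmonic_sub_le {W : ℕ} (hW : W ≠ 0) {y : ℝ} (hy : 1 ≤ y) :
    |∑ n ∈ Icc 1 ⌊y⌋₊, copInd W n / n - (W.totient : ℝ) / W * Real.log y| ≤ harmErr W := by
  have C := abs_sum_mul_div_sub_le (α := 1) (K := 1) (abs_sum_zeta_div_sub_log_le)
    (sum_abs_moebiusDvd_le hW) hy
  rw [moebiusDvd_mul_zeta] at C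
  have h5 : ((1 : ℝ) + 4 * |(1 : ℝ)|) * W.divisors.card = 5 * W.divisors.card := by
    rw [abs_one]; ring
  rw [h5, one_mul] at C
  have hlogy : 0 ≤ Real.log y := Real.log_nonneg hy
  have hτ : (0 : ℝ) ≤ W.divisors.card := Nat.cast_nonneg _
  have hlogW : 0 ≤ Real.log W := Real.log_natCast_nonneg W
  by_cases hWy : W ≤ ⌊y⌋₊
  · rw [sum_moebiusDvd_div_eq hW hWy] at C
    refine C.trans ?_
    unfold harmErr
    nlinarith
  · have hyW : y < W := Nat.lt_of_floor_lt (not_le.1 hWy)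
    have hlog_le : Real.log y ≤ Real.log W := Real.log_le_log (by linarith) hyW.le
    -- `|β_y| ≤ τ(W)`
    have hβ : |∑ d ∈ Icc 1 ⌊y⌋₊, moebiusDvd W d / d| ≤ W.divisors.card := by
      refine (Finset.abs_sum_le_sum_abs _ _).trans ?_
      refine le_trans (Finset.sum_le_sum fun d hd => ?_) (sum_abs_moebiusDvd_le hW ⌊y⌋₊)
      obtain ⟨hd1, -⟩ := Finset.mem_Icc.1 hd
      rw [abs_div, Nat.abs_cast, div_eq_mul_one_div]
      exact mul_le_mul_of_nonneg_left (inv_le_rpow_neg hd1) (abs_nonneg _)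
    have hφ : (W.totient : ℝ) / W ≤ 1 := by
      rw [div_le_one (by exact_mod_cast Nat.pos_of_ne_zero hW)]
      exact_mod_cast Nat.totient_le W
    have hφ0 : 0 ≤ (W.totient : ℝ) / W := by positivity
    set S := ∑ n ∈ Icc 1 ⌊y⌋₊, copInd W n / n
    set β := ∑ d ∈ Icc 1 ⌊y⌋₊, moebiusDvd W d / d
    have e1 : |S - (W.totient : ℝ) / W * Real.log y| ≤
        |S - β * Real.log y| + |β - (W.totient : ℝ) / W| * Real.log y := by
      calc |S - (W.totient : ℝ) / W * Real.log y|
          = |(S - β * Real.log y) + (β - (W.totient : ℝ) / W) * Real.log y| := by ring_nf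
        _ ≤ |S - β * Real.log y| + |(β - (W.totient : ℝ) / W) * Real.log y| := abs_add_le _ _
        _ = _ := by rw [abs_mul, abs_of_nonneg hlogy]
    have e2 : |β - (W.totient : ℝ) / W| ≤ W.divisors.card + 1 := by
      calc |β - (W.totient : ℝ) / W| ≤ |β| + |(W.totient : ℝ) / W| := abs_sub _ _
        _ ≤ W.divisors.card + 1 := by rw [abs_of_nonneg hφ0]; exact add_le_add hβ hφ
    calc |S - (W.totient : ℝ) / W * Real.log y|
        ≤ |S - β * Real.log y| + |β - (W.totient : ℝ) / W| * Real.log y := e1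
      _ ≤ 5 * W.divisors.card + (W.divisors.card + 1) * Real.log W := by
          refine add_le_add C ?_
          exact mul_le_mul e2 hlog_le hlogy (by positivity)
      _ = harmErr W := rfl


/-! ### Weighted squarefree sums: the functions `w_c` and `b_c` -/

section Weighted

variable (W : ℕ) (c : ℕ → ℝ)

/-- `w_c(n) = μ²(n) 𝟙_W(n) ∏_{p ∣ n} (1 + c_p)`: the general squarefree weight coprime to `W`
(`c_p = 1/(p-1)` gives `μ²(n)/φ(n) · n`, `c = 0` gives `μ²(n) 𝟙_W(n)`). [folklore] -/
noncomputable def wfun : ArithmeticFunction ℝ :=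
  ⟨fun n => if n ≠ 0 ∧ Squarefree n ∧ n.Coprime W then ∏ p ∈ n.primeFactors, (1 + c p) else 0,
    by simp⟩

/-- The local data of `b_c`: `b_c(p) = c_p`, `b_c(p²) = -(1 + c_p)`, `b_c(p^j) = 0` (`j ≥ 3`);
the value at exponent `0` is `1` (a convention making `Finsupp.prod` usable). [folklore] -/
noncomputable def bloc (p j : ℕ) : ℝ :=
  if j = 0 then 1 else if j = 1 then c p else if j = 2 then -(1 + c p) else 0

/-- `b_c`: the multiplicative function, supported on integers coprime to `W`, with
`b_c(p) = c_p`, `b_c(p²) = -(1 + c_p)`, `b_c(p^j) = 0` for `j ≥ 3`; it satisfies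
`b_c * 𝟙_W = w_c` (`bfun_mul_copInd`). [folklore] -/
noncomputable def bfun : ArithmeticFunction ℝ :=
  ⟨fun n => if n ≠ 0 ∧ n.Coprime W then n.factorization.prod (bloc c) else 0, by simp⟩

variable {W c}

/-- Unfolding `w_c`. [folklore] -/
theorem wfun_apply (n : ℕ) : wfun W c n =
    if n ≠ 0 ∧ Squarefree n ∧ n.Coprime W then ∏ p ∈ n.primeFactors, (1 + c p) else 0 := rfl

/-- Unfolding `b_c`. [folklore] -/
theorem bfun_apply (n : ℕ) : bfun W c n =
    if n ≠ 0 ∧ n.Coprime W then n.factorization.prod (bloc c) else 0 := rfl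

/-- `w_c(n) = ∏_{p∣n}(1 + c_p)` on squarefree `n ≥ 1` coprime to `W`. [folklore] -/
theorem wfun_apply_of (n : ℕ) (hn : n ≠ 0) (hsq : Squarefree n) (hco : n.Coprime W) :
    wfun W c n = ∏ p ∈ n.primeFactors, (1 + c p) := by
  rw [wfun_apply, if_pos ⟨hn, hsq, hco⟩]

/-- `w_c` vanishes off the squarefree integers. [folklore] -/
theorem wfun_eq_zero_of_not_squarefree {n : ℕ} (h : ¬Squarefree n) : wfun W c n = 0 := by
  rw [wfun_apply, if_neg]; tauto

/-- `w_c` vanishes off the integers coprime to `W`. [folklore] -/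
theorem wfun_eq_zero_of_not_coprime {n : ℕ} (h : ¬n.Coprime W) : wfun W c n = 0 := by
  rw [wfun_apply, if_neg]; tauto

/-- `w_c` is multiplicative. [folklore] -/
theorem isMultiplicative_wfun : (wfun W c).IsMultiplicative := by
  refine IsMultiplicative.iff_ne_zero.2 ⟨?_, ?_⟩
  · rw [wfun_apply, if_pos ⟨one_ne_zero, squarefree_one, Nat.coprime_one_left W⟩]
    simp
  · intro m n hm hn hmn
    by_cases hsq : Squarefree (m * n)
    · have hsqm : Squarefree m := (Nat.squarefree_mul_iff.1 hsq).2.1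
      have hsqn : Squarefree n := (Nat.squarefree_mul_iff.1 hsq).2.2
      by_cases hco : (m * n).Coprime W
      · obtain ⟨h1, h2⟩ := Nat.coprime_mul_iff_left.1 hco
        rw [wfun_apply_of _ (Nat.mul_ne_zero hm hn) hsq hco, wfun_apply_of _ hm hsqm h1,
          wfun_apply_of _ hn hsqn h2, Nat.Coprime.primeFactors_mul hmn,
          Finset.prod_union hmn.disjoint_primeFactors]
      · rw [wfun_eq_zero_of_not_coprime hco]
        rw [Nat.coprime_mul_iff_left, not_and_or] at hco
        rcases hco with h | h
        · rw [wfun_eq_zero_of_not_coprime h, zero_mul]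
        · rw [wfun_eq_zero_of_not_coprime h, mul_zero]
    · rw [wfun_eq_zero_of_not_squarefree hsq]
      rw [Nat.squarefree_mul_iff, not_and_or, not_and_or] at hsq
      rcases hsq with h | h | h
      · exact absurd hmn h
      · rw [wfun_eq_zero_of_not_squarefree h, zero_mul]
      · rw [wfun_eq_zero_of_not_squarefree h, mul_zero]

/-- The local datum at exponent `0` is `1`. [folklore] -/
theorem bloc_zero (p : ℕ) : bloc c p 0 = 1 := by simp [bloc]

/-- `b_c` is multiplicative. [folklore] -/
theorem isMultiplicative_bfun : (bfun W c).IsMultiplicative := by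
  refine IsMultiplicative.iff_ne_zero.2 ⟨?_, ?_⟩
  · rw [bfun_apply, if_pos ⟨one_ne_zero, Nat.coprime_one_left W⟩]
    simp
  · intro m n hm hn hmn
    by_cases hco : (m * n).Coprime W
    · obtain ⟨h1, h2⟩ := Nat.coprime_mul_iff_left.1 hco
      rw [bfun_apply, if_pos ⟨Nat.mul_ne_zero hm hn, hco⟩, bfun_apply, if_pos ⟨hm, h1⟩,
        bfun_apply, if_pos ⟨hn, h2⟩, Nat.factorization_mul_of_coprime hmn,
        Finsupp.prod_add_index_of_disjoint]
      rw [Nat.support_factorization, Nat.support_factorization]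
      exact hmn.disjoint_primeFactors
    · rw [bfun_apply, if_neg (fun h => hco h.2)]
      rw [Nat.coprime_mul_iff_left, not_and_or] at hco
      rcases hco with h | h
      · rw [bfun_apply, if_neg (fun h' => h h'.2), zero_mul]
      · rw [bfun_apply (n := n), if_neg (fun h' => h h'.2), mul_zero]

/-! #### Values at prime powers -/

/-- `𝟙_W` at prime powers: `𝟙_W(p^j) = [p ∤ W]` (`j ≥ 1`). [folklore] -/
theorem copInd_apply_prime_pow {p : ℕ} (hp : p.Prime) {j : ℕ} (hj : j ≠ 0) :
    copInd W (p ^ j) = if p ∣ W then 0 else 1 := by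
  rw [copInd_apply]
  by_cases hpW : p ∣ W
  · have : ¬(p ^ j).Coprime W := fun hc =>
      hp.ne_one (Nat.Coprime.eq_one_of_dvd ((Nat.coprime_pow_left_iff (Nat.pos_of_ne_zero hj) _ _).1 hc) hpW)
    rw [if_neg (fun h => this h.2), if_pos hpW]
  · have : (p ^ j).Coprime W := (Nat.coprime_pow_left_iff (Nat.pos_of_ne_zero hj) _ _).2
      ((Nat.Prime.coprime_iff_not_dvd hp).2 hpW)
    rw [if_pos ⟨pow_ne_zero _ hp.ne_zero, this⟩, if_neg hpW]

/-- `b_c` at prime powers: `b_c(p^j) = [p ∤ W] · bloc(p, j)` (`j ≥ 1`). [folklore] -/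
theorem bfun_apply_prime_pow {p : ℕ} (hp : p.Prime) {j : ℕ} (hj : j ≠ 0) :
    bfun W c (p ^ j) = if p ∣ W then 0 else bloc c p j := by
  rw [bfun_apply]
  by_cases hpW : p ∣ W
  · have : ¬(p ^ j).Coprime W := fun hc =>
      hp.ne_one (Nat.Coprime.eq_one_of_dvd ((Nat.coprime_pow_left_iff (Nat.pos_of_ne_zero hj) _ _).1 hc) hpW)
    rw [if_neg (fun h => this h.2), if_pos hpW]
  · have : (p ^ j).Coprime W := (Nat.coprime_pow_left_iff (Nat.pos_of_ne_zero hj) _ _).2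
      ((Nat.Prime.coprime_iff_not_dvd hp).2 hpW)
    rw [if_pos ⟨pow_ne_zero _ hp.ne_zero, this⟩, if_neg hpW, Nat.Prime.factorization_pow hp,
      Finsupp.prod_single_index (bloc_zero p)]

/-- `w_c` at prime powers: `w_c(p) = [p ∤ W](1 + c_p)`, `w_c(p^j) = 0` for `j ≥ 2`. [folklore] -/
theorem wfun_apply_prime_pow {p : ℕ} (hp : p.Prime) {j : ℕ} (hj : j ≠ 0) :
    wfun W c (p ^ j) = if p ∣ W then 0 else if j = 1 then 1 + c p else 0 := by
  by_cases hpW : p ∣ W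
  · have : ¬(p ^ j).Coprime W := fun hc =>
      hp.ne_one (Nat.Coprime.eq_one_of_dvd ((Nat.coprime_pow_left_iff (Nat.pos_of_ne_zero hj) _ _).1 hc) hpW)
    rw [if_pos hpW, wfun_eq_zero_of_not_coprime this]
  · rw [if_neg hpW]
    have hco : (p ^ j).Coprime W := (Nat.coprime_pow_left_iff (Nat.pos_of_ne_zero hj) _ _).2
      ((Nat.Prime.coprime_iff_not_dvd hp).2 hpW)
    by_cases hj1 : j = 1
    · subst hj1
      rw [if_pos rfl, pow_one, wfun_apply_of p hp.ne_zero hp.squarefree (by simpa using hco),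
        Nat.Prime.primeFactors hp, Finset.prod_singleton]
    · rw [if_neg hj1]
      apply wfun_eq_zero_of_not_squarefree
      intro hsq
      rcases Squarefree.eq_zero_or_one_of_pow_of_not_isUnit hsq hp.not_isUnit with h | h
      · exact hj h
      · exact hj1 h

/-- Dirichlet convolution at a prime power. [folklore] -/
theorem mul_apply_prime_pow (f g : ArithmeticFunction ℝ) {p : ℕ} (hp : p.Prime) (j : ℕ) :
    (f * g) (p ^ j) = ∑ i ∈ Finset.range (j + 1), f (p ^ i) * g (p ^ (j - i)) := by
  rw [ArithmeticFunction.mul_apply,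
    Nat.sum_divisorsAntidiagonal (f := fun a b => f a * g b), Nat.sum_divisors_prime_pow hp]
  refine Finset.sum_congr rfl fun i hi => ?_
  rw [Finset.mem_range] at hi
  rw [Nat.pow_div (by omega) hp.pos]

/-- **`b_c * 𝟙_W = w_c`.** [folklore] -/
theorem bfun_mul_copInd : bfun W c * copInd W = wfun W c := by
  rw [(isMultiplicative_bfun).mul (isMultiplicative_copInd W) |>.eq_iff_eq_on_prime_powers _ _
    isMultiplicative_wfun]
  intro p j hp
  rcases Nat.eq_zero_or_pos j with rfl | hj
  · simp [isMultiplicative_bfun.mul (isMultiplicative_copInd W) |>.map_one,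
      isMultiplicative_wfun.map_one]
  rw [mul_apply_prime_pow _ _ hp, wfun_apply_prime_pow hp hj.ne']
  by_cases hpW : p ∣ W
  · rw [if_pos hpW]
    apply Finset.sum_eq_zero
    intro i hi
    rw [Finset.mem_range] at hi
    rcases Nat.eq_zero_or_pos i with rfl | hi0
    · rw [Nat.sub_zero, copInd_apply_prime_pow hp hj.ne', if_pos hpW, mul_zero]
    · rw [bfun_apply_prime_pow hp hi0.ne', if_pos hpW, zero_mul]
  · rw [if_neg hpW]
    -- all `copInd` factors are `1`
    have hc1 : ∀ i ∈ Finset.range (j + 1), bfun W c (p ^ i) * copInd W (p ^ (j - i)) =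
        bloc c p i := by
      intro i hi
      rw [Finset.mem_range] at hi
      have e2 : copInd W (p ^ (j - i)) = 1 := by
        rcases Nat.eq_zero_or_pos (j - i) with h | h
        · rw [h, pow_zero, copInd_apply, if_pos ⟨one_ne_zero, Nat.coprime_one_left W⟩]
        · rw [copInd_apply_prime_pow hp h.ne', if_neg hpW]
      rw [e2, mul_one]
      rcases Nat.eq_zero_or_pos i with rfl | hi0
      · rw [pow_zero, isMultiplicative_bfun.map_one, bloc_zero]
      · rw [bfun_apply_prime_pow hp hi0.ne', if_neg hpW]
    rw [Finset.sum_congr rfl hc1]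
    -- `Σ_{i ≤ j} bloc i` for `j ≥ 1`
    obtain ⟨j', rfl⟩ := Nat.exists_eq_succ_of_ne_zero hj.ne'
    rcases Nat.eq_zero_or_pos j' with rfl | hj'
    · simp [Finset.sum_range_succ, bloc]
    · obtain ⟨j'', rfl⟩ := Nat.exists_eq_succ_of_ne_zero hj'.ne'
      rw [if_neg (by omega)]
      rw [Finset.sum_range_succ', Finset.sum_range_succ', Finset.sum_range_succ']
      rw [Finset.sum_eq_zero]
      · simp [bloc]
      · intro i _
        simp [bloc]


/-! #### Sums of nonnegative multiplicative functions: the product bound -/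

/-- For a nonnegative multiplicative `f`: `Σ_{d ≤ N} f(d) ≤ ∏_{p ≤ N} Σ_{j ≤ N} f(p^j)` (every
`d ≤ N` divides `∏_{p ≤ N} p^N`). [folklore] -/
theorem sum_le_prod_sum_prime_pow {f : ArithmeticFunction ℝ} (hf : f.IsMultiplicative)
    (h0 : ∀ n, 0 ≤ f n) (N : ℕ) :
    ∑ d ∈ Icc 1 N, f d ≤
      ∏ p ∈ Nat.primesBelow (N + 1), ∑ j ∈ Finset.range (N + 1), f (p ^ j) := by
  set M := ∏ p ∈ Nat.primesBelow (N + 1), p ^ N with hM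
  have hM0 : M ≠ 0 := Finset.prod_ne_zero_iff.2 fun p hp =>
    pow_ne_zero _ (Nat.mem_primesBelow.1 hp).2.ne_zero
  have hdvd : ∀ d ∈ Icc 1 N, d ∣ M := by
    intro d hd
    obtain ⟨hd1, hdN⟩ := Finset.mem_Icc.1 hd
    have hd0 : d ≠ 0 := by omega
    conv_lhs => rw [← Nat.prod_factorization_pow_eq_self hd0]
    have hsub : d.primeFactors ⊆ Nat.primesBelow (N + 1) := fun p hp =>
      Nat.mem_primesBelow.2 ⟨Nat.lt_succ_of_le ((Nat.le_of_mem_primeFactors hp).trans hdN),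
        Nat.prime_of_mem_primeFactors hp⟩
    calc d.factorization.prod (fun p k => p ^ k) = ∏ p ∈ d.primeFactors, p ^ d.factorization p := by
          rw [Finsupp.prod, Nat.support_factorization]
      _ ∣ ∏ p ∈ d.primeFactors, p ^ N := Finset.prod_dvd_prod_of_dvd _ _ fun p _ =>
          pow_dvd_pow p (Nat.factorization_lt p hd0).le |>.trans (pow_dvd_pow p (by omega))
      _ ∣ M := Finset.prod_dvd_prod_of_subset _ _ _ hsub
  have hζ : ((ζ : ArithmeticFunction ℕ) : ArithmeticFunction ℝ).IsMultiplicative :=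
    isMultiplicative_zeta.natCast
  calc ∑ d ∈ Icc 1 N, f d ≤ ∑ d ∈ M.divisors, f d := by
        refine Finset.sum_le_sum_of_subset_of_nonneg (fun d hd => ?_) fun _ _ _ => h0 _
        exact Nat.mem_divisors.2 ⟨hdvd d hd, hM0⟩
    _ = (f * ((ζ : ArithmeticFunction ℕ) : ArithmeticFunction ℝ)) M := by
        rw [ArithmeticFunction.coe_mul_zeta_apply]
    _ = ∏ p ∈ Nat.primesBelow (N + 1),
          (f * ((ζ : ArithmeticFunction ℕ) : ArithmeticFunction ℝ)) (p ^ N) := by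
        rw [hM]
        refine (hf.mul hζ).map_prod (fun p => p ^ N) _ fun p hp q hq hne => ?_
        exact ((Nat.coprime_primes (Nat.mem_primesBelow.1 hp).2 (Nat.mem_primesBelow.1 hq).2).2
          hne).pow N N
    _ = ∏ p ∈ Nat.primesBelow (N + 1), ∑ j ∈ Finset.range (N + 1), f (p ^ j) := by
        refine Finset.prod_congr rfl fun p hp => ?_
        rw [ArithmeticFunction.coe_mul_zeta_apply,
          Nat.sum_divisors_prime_pow (Nat.mem_primesBelow.1 hp).2]

/-- `∏ (1 + ε_p) ≤ exp(Σ ε_p)` for `ε_p ≥ 0`. [folklore] -/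
theorem prod_one_add_le_exp_sum {s : Finset ℕ} {ε : ℕ → ℝ} (h : ∀ p ∈ s, 0 ≤ ε p) :
    ∏ p ∈ s, (1 + ε p) ≤ Real.exp (∑ p ∈ s, ε p) := by
  rw [Real.exp_sum]
  exact Finset.prod_le_prod (fun p hp => by linarith [h p hp]) fun p _ => by
    linarith [Real.add_one_le_exp (ε p)]

/-- `Σ_{p ≤ N prime} p^{-3/2} ≤ 2` (comparison with `∫₁^∞ x^{-3/2} dx = 2`). [folklore] -/
theorem sum_primesBelow_rpow_le (N : ℕ) :
    ∑ p ∈ Nat.primesBelow (N + 1), (p : ℝ) ^ (-(3 : ℝ) / 2) ≤ 2 := by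
  -- compare with `Σ_{i < N} (1 + (i+1))^{-3/2} ≤ ∫_1^{1+N} x^{-3/2} dx`
  have hanti : AntitoneOn (fun x : ℝ => x ^ (-(3 : ℝ) / 2)) (Set.Icc (1 : ℝ) (1 + N)) := by
    intro a ha b _ hab
    exact Real.rpow_le_rpow_of_nonpos (by linarith [ha.1]) hab (by norm_num)
  have hint := AntitoneOn.sum_le_integral (f := fun x : ℝ => x ^ (-(3 : ℝ) / 2)) (x₀ := 1)
    (a := N) hanti
  have hval : ∫ x in (1 : ℝ)..1 + N, x ^ (-(3 : ℝ) / 2) ≤ 2 := by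
    rw [integral_rpow (Or.inr ⟨by norm_num, ?_⟩)]
    · have h1 : (0 : ℝ) ≤ (1 + (N : ℝ)) ^ (-(3 : ℝ) / 2 + 1) := by positivity
      rw [Real.one_rpow]
      have : (-(3 : ℝ) / 2 + 1) = -(1 / 2) := by norm_num
      rw [this] at h1 ⊢
      rw [div_le_iff_of_neg (by norm_num)]
      linarith
    · rw [Set.uIcc_of_le (by linarith [(Nat.cast_nonneg N : (0:ℝ) ≤ N)])]
      intro h
      exact absurd h.1 (by norm_num)
  -- injection `p ↦ p - 2` from the primes `≤ N` into `range N`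
  have hinj : ∑ p ∈ Nat.primesBelow (N + 1), (p : ℝ) ^ (-(3 : ℝ) / 2) ≤
      ∑ i ∈ Finset.range N, ((1 : ℝ) + ((i + 1 : ℕ) : ℝ)) ^ (-(3 : ℝ) / 2) := by
    set f : ℕ → ℝ := fun i => ((1 : ℝ) + ((i + 1 : ℕ) : ℝ)) ^ (-(3 : ℝ) / 2) with hf
    have h1 : ∑ p ∈ Nat.primesBelow (N + 1), (p : ℝ) ^ (-(3 : ℝ) / 2) =
        ∑ p ∈ Nat.primesBelow (N + 1), f (p - 2) := by
      refine Finset.sum_congr rfl fun p hp => ?_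
      have h2 := (Nat.mem_primesBelow.1 hp).2.two_le
      simp only [hf]
      congr 1
      push_cast [Nat.cast_sub h2]
      ring
    have h2 : Set.InjOn (fun p => p - 2) (Nat.primesBelow (N + 1) : Set ℕ) := by
      intro p hp q hq h
      have := (Nat.mem_primesBelow.1 hp).2.two_le
      have := (Nat.mem_primesBelow.1 hq).2.two_le
      simp only at h; omega
    rw [h1, ← Finset.sum_image h2]
    refine Finset.sum_le_sum_of_subset_of_nonneg ?_ fun _ _ _ => by positivity
    intro i hi
    rw [Finset.mem_image] at hi
    obtain ⟨p, hp, rfl⟩ := hi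
    obtain ⟨hpN, hpp⟩ := Nat.mem_primesBelow.1 hp
    have := hpp.two_le
    rw [Finset.mem_range]; omega
  exact hinj.trans (hint.trans hval)

/-! #### The `d^{-3/4}`-moment of `b_c` -/

/-- `|b_c| · d^{-3/4}` as a (nonnegative, multiplicative) arithmetic function. [folklore] -/
noncomputable def babs (W : ℕ) (c : ℕ → ℝ) : ArithmeticFunction ℝ :=
  ⟨fun d => |bfun W c d| * (d : ℝ) ^ (-(3 : ℝ) / 4), by simp⟩

/-- Unfolding `|b_c| d^{-3/4}`. [folklore] -/
theorem babs_apply (d : ℕ) : babs W c d = |bfun W c d| * (d : ℝ) ^ (-(3 : ℝ) / 4) := rfl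

/-- `|b_c| d^{-3/4} ≥ 0`. [folklore] -/
theorem babs_nonneg (d : ℕ) : 0 ≤ babs W c d := by
  rw [babs_apply]; positivity

/-- `|b_c| d^{-3/4}` is multiplicative. [folklore] -/
theorem isMultiplicative_babs : (babs W c).IsMultiplicative := by
  refine ⟨?_, ?_⟩
  · rw [babs_apply, isMultiplicative_bfun.map_one]; simp
  · intro m n hmn
    rw [babs_apply, babs_apply, babs_apply, isMultiplicative_bfun.map_mul_of_coprime hmn,
      abs_mul, Nat.cast_mul, Real.mul_rpow (Nat.cast_nonneg _) (Nat.cast_nonneg _)]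
    ring

/-- The constant `B(C₀) = exp(2 (1 + 2 C₀))` bounding `Σ_d |b_c(d)| d^{-3/4}` when
`|c_p| ≤ C₀/p`. [folklore] -/
noncomputable def bConst (C₀ : ℝ) : ℝ := Real.exp (2 * (1 + 2 * C₀))

/-- `B(C₀) ≥ 1` for `C₀ ≥ 0`. [folklore] -/
theorem one_le_bConst {C₀ : ℝ} (h : 0 ≤ C₀) : 1 ≤ bConst C₀ := by
  unfold bConst; exact Real.one_le_exp (by positivity)

/-- **Moment bound.** If `|c_p| ≤ C₀/p` for all primes `p`, then
`Σ_{d ≤ N} |b_c(d)| d^{-3/4} ≤ exp(2(1 + 2C₀))` for every `N`. [folklore] -/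
theorem sum_babs_le {C₀ : ℝ} (hc : ∀ p, p.Prime → |c p| ≤ C₀ / p) (N : ℕ) :
    ∑ d ∈ Icc 1 N, |bfun W c d| * (d : ℝ) ^ (-(3 : ℝ) / 4) ≤ bConst C₀ := by
  have hC₀ : 0 ≤ C₀ := by
    have := hc 2 Nat.prime_two
    have h2 : (0 : ℝ) ≤ C₀ / 2 := le_trans (abs_nonneg _) this
    linarith
  have step1 := sum_le_prod_sum_prime_pow (isMultiplicative_babs (W := W) (c := c))
    (babs_nonneg) N
  simp only [babs_apply] at step1
  refine step1.trans ?_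
  -- local factors
  have hloc : ∀ p ∈ Nat.primesBelow (N + 1),
      ∑ j ∈ Finset.range (N + 1), |bfun W c (p ^ j)| * ((p ^ j : ℕ) : ℝ) ^ (-(3 : ℝ) / 4) ≤
        1 + (1 + 2 * C₀) * (p : ℝ) ^ (-(3 : ℝ) / 2) := by
    intro p hp
    have hpp := (Nat.mem_primesBelow.1 hp).2
    have hp1 : (1 : ℝ) ≤ p := by exact_mod_cast hpp.one_lt.le
    have hp0 : (0 : ℝ) < p := by linarith
    -- terms with `j ≥ 3` vanish
    have hvan : ∀ j ∈ Finset.range (N + 1), ¬j < 3 →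
        |bfun W c (p ^ j)| * ((p ^ j : ℕ) : ℝ) ^ (-(3 : ℝ) / 4) = 0 := by
      intro j _ hj
      rw [bfun_apply_prime_pow hpp (by omega)]
      split_ifs
      · simp
      · simp [bloc, show j ≠ 0 by omega, show j ≠ 1 by omega, show j ≠ 2 by omega]
    rw [← Finset.sum_filter_of_ne (p := fun j => j < 3) (fun j hj hne => by
      by_contra h; exact hne (hvan j hj h))]
    have hsub : (Finset.range (N + 1)).filter (fun j => j < 3) ⊆ Finset.range 3 := by
      intro j hj; simp only [Finset.mem_filter, Finset.mem_range] at hj ⊢; exact hj.2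
    refine (Finset.sum_le_sum_of_subset_of_nonneg hsub fun _ _ _ => by positivity).trans ?_
    rw [Finset.sum_range_succ, Finset.sum_range_succ, Finset.sum_range_succ, Finset.sum_range_zero,
      zero_add, pow_zero, isMultiplicative_bfun.map_one, pow_one]
    simp only [abs_one, Nat.cast_one, Real.one_rpow, mul_one]
    -- `|b(p)| p^{-3/4} ≤ C₀ p^{-3/2}` and `|b(p²)| (p²)^{-3/4} ≤ (1 + C₀) p^{-3/2}`
    have hcp : |c p| ≤ C₀ / p := hc p hpp
    have hcp' : |c p| ≤ C₀ := hcp.trans (div_le_self hC₀ hp1)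
    have e1 : |bfun W c p| ≤ C₀ / p := by
      have := bfun_apply_prime_pow (W := W) (c := c) hpp one_ne_zero
      rw [pow_one] at this
      rw [this]; split_ifs
      · simp only [abs_zero]; positivity
      · simpa [bloc] using hcp
    have e2 : |bfun W c (p ^ 2)| ≤ 1 + C₀ := by
      rw [bfun_apply_prime_pow hpp two_ne_zero]; split_ifs
      · simp only [abs_zero]; positivity
      · simp only [bloc, OfNat.ofNat_ne_zero, ↓reduceIte, OfNat.ofNat_ne_one, abs_neg]
        calc |1 + c p| ≤ |(1 : ℝ)| + |c p| := abs_add_le _ _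
          _ ≤ 1 + C₀ := by rw [abs_one]; linarith
    have r1 : (p : ℝ) ^ (-(3 : ℝ) / 4) ≤ (p : ℝ) * (p : ℝ) ^ (-(3 : ℝ) / 2) := by
      rw [show (p : ℝ) * (p : ℝ) ^ (-(3 : ℝ) / 2) = (p : ℝ) ^ (-(1 : ℝ) / 2) by
        rw [← Real.rpow_one_add' hp0.le (by norm_num)]; norm_num]
      exact Real.rpow_le_rpow_of_exponent_le hp1 (by norm_num)
    have r2 : (((p ^ 2 : ℕ) : ℝ)) ^ (-(3 : ℝ) / 4) = (p : ℝ) ^ (-(3 : ℝ) / 2) := by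
      push_cast
      rw [← Real.rpow_natCast, ← Real.rpow_mul hp0.le]; norm_num
    rw [r2]
    have t1 : |bfun W c p| * (p : ℝ) ^ (-(3 : ℝ) / 4) ≤ C₀ * (p : ℝ) ^ (-(3 : ℝ) / 2) := by
      calc |bfun W c p| * (p : ℝ) ^ (-(3 : ℝ) / 4) ≤ (C₀ / p) * ((p : ℝ) * (p : ℝ) ^ (-(3 : ℝ) / 2)) :=
            mul_le_mul e1 r1 (by positivity) (by positivity)
        _ = C₀ * (p : ℝ) ^ (-(3 : ℝ) / 2) := by field_simp
    have t2 : |bfun W c (p ^ 2)| * (p : ℝ) ^ (-(3 : ℝ) / 2) ≤ (1 + C₀) * (p : ℝ) ^ (-(3 : ℝ) / 2) :=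
      mul_le_mul_of_nonneg_right e2 (by positivity)
    nlinarith [t1, t2]
  calc ∏ p ∈ Nat.primesBelow (N + 1), ∑ j ∈ Finset.range (N + 1),
          |bfun W c (p ^ j)| * ((p ^ j : ℕ) : ℝ) ^ (-(3 : ℝ) / 4)
      ≤ ∏ p ∈ Nat.primesBelow (N + 1), (1 + (1 + 2 * C₀) * (p : ℝ) ^ (-(3 : ℝ) / 2)) := by
        refine Finset.prod_le_prod (fun p _ => Finset.sum_nonneg fun _ _ => by positivity) hloc
    _ ≤ Real.exp (∑ p ∈ Nat.primesBelow (N + 1), (1 + 2 * C₀) * (p : ℝ) ^ (-(3 : ℝ) / 2)) :=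
        prod_one_add_le_exp_sum fun p _ => by positivity
    _ ≤ bConst C₀ := by
        unfold bConst
        rw [Real.exp_le_exp, ← Finset.mul_sum]
        calc (1 + 2 * C₀) * ∑ p ∈ Nat.primesBelow (N + 1), (p : ℝ) ^ (-(3 : ℝ) / 2)
            ≤ (1 + 2 * C₀) * 2 :=
              mul_le_mul_of_nonneg_left (sum_primesBelow_rpow_le N) (by positivity)
          _ = 2 * (1 + 2 * C₀) := by ring


/-! #### The two-sided estimate for `Σ_{n ≤ x} w_c(n)/n` -/

/-- `β_c(x) = Σ_{d ≤ x} b_c(d)/d`, the partial sum of the (absolutely convergent) series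
`Σ_d b_c(d)/d = ∏_{p ∤ W} (1 + c_p/p − (1 + c_p)/p²)`. [folklore] -/
noncomputable def bsum (W : ℕ) (c : ℕ → ℝ) (x : ℝ) : ℝ := ∑ d ∈ Icc 1 ⌊x⌋₊, bfun W c d / d

/-- Unfolding `β_c`. [folklore] -/
theorem bsum_def (x : ℝ) : bsum W c x = ∑ d ∈ Icc 1 ⌊x⌋₊, bfun W c d / d := rfl

/-- **Two-sided estimate for weighted squarefree sums coprime to `W`.** If `W ≥ 1` and
`|c_p| ≤ C₀/p` for all primes, then for real `x ≥ 1`,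
`|Σ_{n ≤ x} w_c(n)/n − (φ(W)/W) β_c(x) log x| ≤ (harmErr W + 4) · B(C₀)`, where
`w_c(n) = μ²(n) 𝟙_{(n,W)=1} ∏_{p∣n}(1 + c_p)` and `β_c(x) = 1 + O(D₀^{-1/4})` when every prime
`≤ D₀` divides `W` (`abs_bsum_sub_one_le`). (The classical evaluation, e.g. for `c_p = 1/(p−1)`:
`Σ_{n ≤ x,(n,W)=1} μ²(n)/φ(n) = (φ(W)/W)(log x + O_W(1))`, Halberstam–Richert, *Sieve Methods*,
Ch. 3 (3.1.11)–Lemma 3.1; here with a crude but explicit error.) [folklore] -/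
theorem abs_sum_wfun_div_sub_le (hW : W ≠ 0) {C₀ : ℝ} (hc : ∀ p, p.Prime → |c p| ≤ C₀ / p)
    {x : ℝ} (hx : 1 ≤ x) :
    |∑ n ∈ Icc 1 ⌊x⌋₊, wfun W c n / n - (W.totient : ℝ) / W * bsum W c x * Real.log x| ≤
      (harmErr W + 4) * bConst C₀ := by
  have hC₀ : 0 ≤ C₀ := by
    have := hc 2 Nat.prime_two
    have h2 : (0 : ℝ) ≤ C₀ / 2 := le_trans (abs_nonneg _) this
    linarith
  have C := abs_sum_mul_div_sub_le (a := copInd W) (b := bfun W c) (α := (W.totient : ℝ) / W)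
    (K := harmErr W) (B := bConst C₀) (fun y hy => abs_coprimeHarmonic_sub_le hW hy)
    (sum_babs_le hc) hx
  rw [bfun_mul_copInd] at C
  refine C.trans ?_
  have hφ : |(W.totient : ℝ) / W| ≤ 1 := by
    rw [abs_of_nonneg (by positivity), div_le_one (by exact_mod_cast Nat.pos_of_ne_zero hW)]
    exact_mod_cast Nat.totient_le W
  have hB : 0 ≤ bConst C₀ := (zero_le_one.trans (one_le_bConst hC₀))
  have hH := harmErr_nonneg W
  nlinarith

/-- If every prime `≤ D₀` divides `W`, an integer `d > 1` coprime to `W` exceeds `D₀`. [folklore] -/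
theorem lt_of_coprime_of_one_lt {D₀ : ℕ} (hD : ∀ p, p.Prime → p ≤ D₀ → p ∣ W) {d : ℕ}
    (hd : 1 < d) (hco : d.Coprime W) : D₀ < d := by
  by_contra h
  have hle : d ≤ D₀ := not_lt.1 h
  have hp := Nat.minFac_prime hd.ne'
  have hpd : d.minFac ∣ d := Nat.minFac_dvd d
  have hpW : d.minFac ∣ W := hD _ hp ((Nat.minFac_le (by omega)).trans hle)
  exact hp.ne_one (Nat.Coprime.eq_one_of_dvd (Nat.Coprime.coprime_dvd_left hpd hco) hpW)

/-- `β_c(x) = 1 + Σ_{D₀ < d ≤ x} b_c(d)/d` when every prime `≤ D₀` divides `W` (`D₀ ≥ 1`, `x ≥ 1`).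
[folklore] -/
theorem bsum_eq_one_add {D₀ : ℕ} (hD0 : 1 ≤ D₀) (hD : ∀ p, p.Prime → p ≤ D₀ → p ∣ W) {x : ℝ}
    (hx : 1 ≤ x) : bsum W c x = 1 + ∑ d ∈ Ioc D₀ ⌊x⌋₊, bfun W c d / d := by
  have hX : 1 ≤ ⌊x⌋₊ := Nat.le_floor (by simpa using hx)
  rw [bsum_def]
  have h1 : Icc 1 ⌊x⌋₊ = insert 1 (Ioc 1 ⌊x⌋₊) := by
    ext d; simp only [Finset.mem_Icc, Finset.mem_insert, Finset.mem_Ioc]; omega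
  rw [h1, Finset.sum_insert (by simp), isMultiplicative_bfun.map_one, Nat.cast_one, div_one]
  congr 1
  rw [← Finset.sum_filter_of_ne (p := fun d => D₀ < d)]
  · congr 1
    ext d; simp only [Finset.mem_filter, Finset.mem_Ioc]; omega
  · intro d hd hne
    rw [Finset.mem_Ioc] at hd
    by_contra hle
    apply hne
    have : ¬d.Coprime W := fun hco => hle (lt_of_coprime_of_one_lt hD hd.1 hco)
    rw [bfun_apply, if_neg (fun h => this h.2), zero_div]

/-- **`β_c(x) = 1 + O(D₀^{-1/4})`.** If every prime `≤ D₀` divides `W` (`D₀ ≥ 1`) and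
`|c_p| ≤ C₀/p`, then `|β_c(x) − 1| ≤ B(C₀) D₀^{-1/4}` for all `x ≥ 1`. [folklore] -/
theorem abs_bsum_sub_one_le {C₀ : ℝ} (hc : ∀ p, p.Prime → |c p| ≤ C₀ / p) {D₀ : ℕ}
    (hD0 : 1 ≤ D₀) (hD : ∀ p, p.Prime → p ≤ D₀ → p ∣ W) {x : ℝ} (hx : 1 ≤ x) :
    |bsum W c x - 1| ≤ bConst C₀ * (D₀ : ℝ) ^ (-(1 : ℝ) / 4) := by
  rw [bsum_eq_one_add hD0 hD hx, add_sub_cancel_left]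
  exact abs_sum_Ioc_div_le (sum_babs_le hc) hD0

end Weighted

end SquarefreeSums

end Literature.NumberTheory.Sieve
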